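import Summits.Langlands.Langlands.Theorems.IrreducibilityBySelfDualityIrreducibleOffSectorTransfer
import Literature.NumberTheory.Automorphic.QuadraticBaseChangeFrobCompatibleProofs
import HarnessLib

/-!
# Base-change descent of the conclusion of `IrreducibleOffSector`
(crux stmt-Langlands-14329 `IrreducibilityBySelfDuality.IrreducibleOffSector`, line `Sketch`;
`--supports` file, STRUCTURAL: no import of the route module; continuation lead c4)

The crux says: for a cuspidal L-algebraic `π` on `GL_n(𝔸_K)` off the sector, every
`ρ : Γ_K → GL_n(ℚ̄_ℓ)` that is Satake–Frobenius compatible with `(π, ι)` at almost every place is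
irreducible.  This file records the second STRUCTURAL closure property of that conclusion (the
first, closure under algebraic twists, is `…IrreducibleOffSectorTwist`, p120193): it DESCENDS along
weak base change.  Let `L ⊇ K` be any finite extension of number fields and `Π` on `GL_n(𝔸_L)` a
weak base-change lift of `π` (`IsWeakBaseChangeLiftAE π Π`, Arthur–Clozel Ch. 3 (1.1), Def. 1.1:
`t_{Π,w} = t_{π,v}^{f(w|v)}` for almost every `w ∣ v`; no normality, cyclicity or cuspidality is
needed).  If every `ρ' : Γ_L → GL_n(ℚ̄_ℓ)` a.e.-compatible with `(Π, ι)` is irreducible, then every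
`ρ : Γ_K → GL_n(ℚ̄_ℓ)` a.e.-compatible with `(π, ι)` is irreducible
(`isIrreducible_of_isWeakBaseChangeLiftAE`): the restriction `ρ|_{Γ_L}` is a.e.-compatible with
`Π` (`eventually_satakeFrobCompatible_restrictField_of_isWeakBaseChangeLiftAE`: `Frob_w = Frob_v^{f}`
on the unramified `ρ`, `q_w = q_v^{f}`, and `arithFrobPolyOfSatake ι q_w 1 (α^f)` is the `f`-th power
transform), hence irreducible, and a `Γ_K`-stable subspace is `Γ_L`-stable
(`isIrreducible_of_isIrreducible_restrictField`).  In the crux's binder shape: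
`irreducibleOffSector_conclusion_of_baseChange` — the slice of the crux text over `L` in rank `n`,
applied to a CUSPIDAL, L-algebraic, off-sector weak base-change lift `Π` of `π`, yields the crux's
conclusion for `π` over `K` (whatever `K`, and whether or not `π` itself is off the sector or
L-algebraic).  So every region of the crux closed over `L` (the `n = 1` slice, the Galois-type
region p119699, the regular totally-real/CM regions of the c2 map, …) pulls back to the `π` over
sub-fields `K ⊆ L` whose base change to `L` stays cuspidal and lands in it.

References: J. Arthur, L. Clozel, *Simple algebras, base change, and the advanced theory of the
trace formula*, Ann. of Math. Stud. 120 (1989), Ch. 3 §1 (1.1), Def. 1.1; M. Harris, R. Taylor,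
*The geometry and cohomology of some simple Shimura varieties* (2001), proof of Thm. VII.1.9
(restriction of the attached representation along base change); J.-P. Serre, *Abelian ℓ-adic
representations and elliptic curves* (1968), Ch. I §2.1.
-/

noncomputable section

set_option linter.dupNamespace false

open scoped NumberField Classical Matrix
open Filter IsDedekindDomain
open Literature.NumberTheory.Automorphic Literature.NumberTheory.GaloisRepresentations
open Summit.Langlands

namespace Summit.Langlands.Langlands.Theorems.IrreducibleOffSector

section Descent

variable {K : Type} [Field K] [NumberField K] {L : Type} [Field L] [NumberField L] [Algebra K L]
  {ℓ : ℕ} [Fact ℓ.Prime] {n : ℕ}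

omit [NumberField K] [NumberField L] in
/-- **Irreducibility of `ρ|_{Γ_L}` implies irreducibility of `ρ`**: a `ρ(Γ_K)`-stable subspace of
`ℚ̄_ℓⁿ` is stable under `ρ(res(Γ_L))`, so the lattice of `ρ`-subrepresentations embeds, preserving
`⊥` and `⊤`, into that of `ρ|_{Γ_L}`; a simple target lattice forces a simple source lattice.
(Same statement as `SkinnerWilesDefectOne.isIrreducible_of_isIrreducible_restrictField`, re-proved
here in a few lines to keep this structural file free of that route's imports.)
Serre, *Abelian ℓ-adic representations* (1968), Ch. I §2.1. [folklore] -/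
theorem isIrreducible_of_isIrreducible_restrictField (ρ : FramedGaloisRep K (PadicAlgCl ℓ) n)
    (h : (ρ.restrictField L).toGaloisRep.IsIrreducible) : ρ.toGaloisRep.IsIrreducible := by
  let T : Subrepresentation ρ.toGaloisRep.toRepresentation →
      Subrepresentation (ρ.restrictField L).toGaloisRep.toRepresentation := fun W =>
    ⟨W.toSubmodule, fun σ v hv => by
      have e : (ρ.restrictField L).toGaloisRep.toRepresentation σ v =
          ρ.toGaloisRep.toRepresentation (absGaloisRestrict K L σ) v := by
        change (((ρ.restrictField L) σ : GL (Fin n) (PadicAlgCl ℓ)) :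
            Matrix (Fin n) (Fin n) (PadicAlgCl ℓ)) *ᵥ v =
          ((ρ (absGaloisRestrict K L σ) : GL (Fin n) (PadicAlgCl ℓ)) :
            Matrix (Fin n) (Fin n) (PadicAlgCl ℓ)) *ᵥ v
        rw [FramedGaloisRep.restrictField_apply]
      rw [e]
      exact W.apply_mem_toSubmodule (absGaloisRestrict K L σ) hv⟩
  have hT : ∀ W, (T W).toSubmodule = W.toSubmodule := fun W => rfl
  haveI := h
  have hbt : (⊥ : Subrepresentation (ρ.restrictField L).toGaloisRep.toRepresentation) ≠ ⊤ :=
    bot_ne_top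
  refine { exists_pair_ne := ⟨⊥, ⊤, fun hbt' => hbt ?_⟩, eq_bot_or_eq_top := fun W => ?_ }
  · exact Subrepresentation.toSubmodule_injective
      (congrArg Subrepresentation.toSubmodule hbt' :)
  · refine (IsSimpleOrder.eq_bot_or_eq_top (T W)).imp (fun h0 => ?_) (fun h1 => ?_) <;>
      apply Subrepresentation.toSubmodule_injective
    · rw [← hT W, h0]; rfl
    · rw [← hT W, h1]; rfl

/-- **Satake–Frobenius compatibility restricts along a weak base change** (crux binder shape):
if `ρ` is a.e. `SatakeFrobCompatibleAt ι π ρ v` and `Π` is a weak base-change lift of `π`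
(`IsWeakBaseChangeLiftAE`), then `ρ|_{Γ_L}` is a.e. `SatakeFrobCompatibleAt ι Π (ρ|_{Γ_L}) w` —
the case `m = 1` of `eventually_satakeFrobCompatible_restrictField_of_isWeakBaseChangeLiftAE`
(Arthur–Clozel Ch. 3 (1.1); Harris–Taylor, proof of Thm. VII.1.9).
[cite: ArthurClozelAMS120, Ch. 3 §1 (1.1) and Def. 1.1] -/
theorem eventually_satakeFrobCompatibleAt_restrictField
    {hK : isCompact_glFiniteIntegralLevel n K} {hL : isCompact_glFiniteIntegralLevel n L}
    (ι : PadicAlgCl ℓ ≃+* ℂ) (π : AutomorphicRepData (AutomorphyDatum.gl n K hK))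
    (P : AutomorphicRepData (AutomorphyDatum.gl n L hL)) (hBC : IsWeakBaseChangeLiftAE π P)
    (ρ : FramedGaloisRep K (PadicAlgCl ℓ) n)
    (hρ : ∀ᶠ v : HeightOneSpectrum (𝓞 K) in cofinite, SatakeFrobCompatibleAt ι π ρ v) :
    ∀ᶠ w : HeightOneSpectrum (𝓞 L) in cofinite, SatakeFrobCompatibleAt ι P (ρ.restrictField L) w :=
  eventually_satakeFrobCompatible_restrictField_of_isWeakBaseChangeLiftAE ι 1 π P hBC ρ hρ

end Descent

section Main

/-- **Base-change descent of the crux's conclusion.**  Let `Π` on `GL_n(𝔸_L)` be a weak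
base-change lift of `π` on `GL_n(𝔸_K)` (`IsWeakBaseChangeLiftAE`; `L ⊇ K` arbitrary finite).  If
every `ρ' : Γ_L → GL_n(ℚ̄_ℓ)` Satake–Frobenius compatible with `(Π, ι)` almost everywhere is
irreducible, then every `ρ : Γ_K → GL_n(ℚ̄_ℓ)` Satake–Frobenius compatible with `(π, ι)` almost
everywhere is irreducible: `ρ|_{Γ_L}` is compatible with `Π`, hence irreducible, hence so is `ρ`.
No cuspidality, algebraicity, regularity or Galois hypothesis is used.
[cite: ArthurClozelAMS120, Ch. 3 §1 (1.1) and Def. 1.1] -/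
theorem isIrreducible_of_isWeakBaseChangeLiftAE {K : Type} [Field K] [NumberField K]
    {L : Type} [Field L] [NumberField L] [Algebra K L] {ℓ : ℕ} [Fact ℓ.Prime] {n : ℕ}
    {hK : isCompact_glFiniteIntegralLevel n K} {hL : isCompact_glFiniteIntegralLevel n L}
    (ι : PadicAlgCl ℓ ≃+* ℂ) (π : AutomorphicRepData (AutomorphyDatum.gl n K hK))
    (P : AutomorphicRepData (AutomorphyDatum.gl n L hL)) (hBC : IsWeakBaseChangeLiftAE π P)
    (hP : ∀ ρ' : FramedGaloisRep L (PadicAlgCl ℓ) n,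
      (∀ᶠ w : HeightOneSpectrum (𝓞 L) in cofinite, SatakeFrobCompatibleAt ι P ρ' w) →
        ρ'.toGaloisRep.IsIrreducible)
    (ρ : FramedGaloisRep K (PadicAlgCl ℓ) n)
    (hρ : ∀ᶠ v : HeightOneSpectrum (𝓞 K) in cofinite, SatakeFrobCompatibleAt ι π ρ v) :
    ρ.toGaloisRep.IsIrreducible :=
  isIrreducible_of_isIrreducible_restrictField (L := L) ρ
    (hP _ (eventually_satakeFrobCompatibleAt_restrictField ι π P hBC ρ hρ))

/-- **The crux descends along cuspidal base change** (crux binder shape).  GIVEN the slice of the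
text of `IrreducibleOffSector` over the number field `L` in rank `n` (hypothesis `hIL`: every
cuspidal L-algebraic `Π` on `GL_n(𝔸_L)` off the sector `n = 3 ∧ L CM ∧ regular` has only
irreducible a.e.-compatible `ρ'`), then for every `π` on `GL_n(𝔸_K)`, `K ⊆ L`, admitting a
CUSPIDAL weak base-change lift `Π` to `L` that is L-algebraic and off the sector over `L`, every
`ρ : Γ_K → GL_n(ℚ̄_ℓ)` a.e.-compatible with `(π, ι)` is irreducible.  (For `L/K` cyclic of prime
degree, L-algebraicity of `Π` follows from that of `π`: `isLAlgebraic_baseChange` given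
Arthur–Clozel's archimedean strong lifting; it is kept as a hypothesis here so that no named fact
enters.)  [cite: ArthurClozelAMS120, Ch. 3 §1 (1.1) and Def. 1.1] -/
theorem irreducibleOffSector_conclusion_of_baseChange {K : Type} [Field K] [NumberField K]
    {L : Type} [Field L] [NumberField L] [Algebra K L] {ℓ : ℕ} [Fact ℓ.Prime] {n : ℕ}
    (hIL : ∀ (hL : isCompact_glFiniteIntegralLevel n L) (P : CuspidalAutomorphicRepData n L hL),
      P.1.IsLAlgebraic →
        ¬ (n = 3 ∧ NumberField.IsCMField L ∧ ∃ T : InfinityType L n, P.1.HasInfinityType T ∧ T.IsRegular) →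
          ∀ (ℓ : ℕ) [Fact ℓ.Prime] (ι : PadicAlgCl ℓ ≃+* ℂ) (ρ' : FramedGaloisRep L (PadicAlgCl ℓ) n),
            (∀ᶠ w : HeightOneSpectrum (𝓞 L) in cofinite, SatakeFrobCompatibleAt ι P.1 ρ' w) →
              ρ'.toGaloisRep.IsIrreducible)
    {hK : isCompact_glFiniteIntegralLevel n K} {hL : isCompact_glFiniteIntegralLevel n L}
    (π : AutomorphicRepData (AutomorphyDatum.gl n K hK)) (P : CuspidalAutomorphicRepData n L hL)
    (hBC : IsWeakBaseChangeLiftAE π P.1) (hPalg : P.1.IsLAlgebraic)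
    (hPsec : ¬ (n = 3 ∧ NumberField.IsCMField L ∧ ∃ T : InfinityType L n, P.1.HasInfinityType T ∧ T.IsRegular))
    (ι : PadicAlgCl ℓ ≃+* ℂ) (ρ : FramedGaloisRep K (PadicAlgCl ℓ) n)
    (hρ : ∀ᶠ v : HeightOneSpectrum (𝓞 K) in cofinite, SatakeFrobCompatibleAt ι π ρ v) :
    ρ.toGaloisRep.IsIrreducible :=
  isIrreducible_of_isWeakBaseChangeLiftAE ι π P.1 hBC (fun ρ' hρ' => hIL hL P hPalg hPsec ℓ ι ρ' hρ')
    ρ hρ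

end Main

end Summit.Langlands.Langlands.Theorems.IrreducibleOffSector

end
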